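import Mathlib
import Summits.AtomisticToContinuum.Crystallization.Theses.PhononSlackCertificates

/-!
# Sketch (crux-ideate, ideator 1, round 1) — crux `HullBridge` (stmt-AtomisticToContinuum-15147)

First lemmas of the idea card `merge-the-certified-fits` (fits, not shells): the BI-LAYERED LEMMA for
the explicit box family of `LayeredWindows` / `NearFieldConvexity`, and its in-plane propagation
corollary. Statements only (`sorry`); they must elaborate.
-/

namespace Summit.AtomisticToContinuum.Crystallization.Cruxes.HullBridge.MergeFitsIdeator1

open Literature.MathematicalPhysics.StatisticalMechanics

local notation "E3" => EuclideanSpace ℝ (Fin 3)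

/-- The box-layered set of the route's window format (`LayeredWindows`, `NearFieldConvexity`):
rigid image under `A` of triangular layers of spacing `a`, hole letters integrated from the Hägg
steps `s`, free heights `z`. -/
def layeredSet (A : E3 →ₗᵢ[ℝ] E3) (a : ℝ) (s : ℤ → ℤ) (z : ℤ → ℝ) : Set E3 :=
  {p | ∃ m i j : ℤ, p = A (((i : ℝ) • triangularVec₁ a) + ((j : ℝ) • triangularVec₂ a) +
        ((haggLabel s m : ℝ) • barlowOffset a) + (z m • layerNormal 1))}

/-- The box of the route: `a ∈ [47/50, 1]`, `s` a Hägg (`±1`) sequence, gaps in `[39a/50, 17a/20]`. -/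
def InBox (a : ℝ) (s : ℤ → ℤ) (z : ℤ → ℝ) : Prop :=
  47 / 50 ≤ a ∧ a ≤ 1 ∧ IsHaggSeq s ∧
    ∀ m : ℤ, 39 / 50 * a ≤ z (m + 1) - z m ∧ z (m + 1) - z m ≤ 17 / 20 * a

/-- **Bi-layered lemma** (exact, closed 2-ball centred at a common site, here the origin).
If two box-layered sets coincide on the closed 2-ball around a common site, then either their layer
normals are parallel, or the piece is ideal fcc there: every gap between consecutive VISIBLE layers
(`|z m| ≤ 2`; the origin's layer has height `0`) equals `a √(2/3)` and every layer whose two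
neighbours are visible carries the letter `c` (`s m = s (m-1)`). Grid evidence:
`scratch/bilayer_check.py` (5184 pieces; 8 bi-layered, all ideal-fcc; second normals at 70.53°). -/
theorem stub_biLayered (A A' : E3 →ₗᵢ[ℝ] E3) (a a' : ℝ) (s s' : ℤ → ℤ) (z z' : ℤ → ℝ)
    (hb : InBox a s z) (hb' : InBox a' s' z')
    (h0 : (0 : E3) ∈ layeredSet A a s z) (h0' : (0 : E3) ∈ layeredSet A' a' s' z')
    (hcoin : ∀ p : E3, ‖p‖ ≤ 2 → (p ∈ layeredSet A a s z ↔ p ∈ layeredSet A' a' s' z')) :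
    (A' (layerNormal 1) = A (layerNormal 1) ∨ A' (layerNormal 1) = -A (layerNormal 1)) ∨
    ((∀ m : ℤ, |z m| ≤ 2 → |z (m + 1)| ≤ 2 → z (m + 1) - z m = a * Real.sqrt (2 / 3)) ∧
      (∀ m : ℤ, |z (m - 1)| ≤ 2 → |z (m + 1)| ≤ 2 → s m = s (m - 1))) := by
  sorry

/-- **In-plane propagation of pinning** (exact corollary, the completeness engine for sheets).
`X` is the particle set; the closed 2-balls of the site `0` and of its in-plane neighbour
`q = A u` (first triangular generator) are pieces of box-layered sets `S`, `S'`. If the ball of `0`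
is PINNED (not an ideal-fcc piece: some visible gap non-ideal or some visible letter `h`), then `S'`
has the same normal line as `S` — so pinned sites come in complete in-plane-connected sheets.
Grid evidence: `scratch/lens_check.py` (in-plane lenses: bi-layered only over ideal-fcc balls). -/
theorem stub_inplanePropagation (X : Set E3) (A A' : E3 →ₗᵢ[ℝ] E3) (a a' : ℝ) (s s' : ℤ → ℤ)
    (z z' : ℤ → ℝ) (hb : InBox a s z) (hb' : InBox a' s' z')
    (h0 : (0 : E3) ∈ layeredSet A a s z)
    (hfit : ∀ p : E3, ‖p‖ ≤ 2 → (p ∈ X ↔ p ∈ layeredSet A a s z))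
    (hfit' : ∀ p : E3, dist p (A (triangularVec₁ a)) ≤ 2 → (p ∈ X ↔ p ∈ layeredSet A' a' s' z'))
    (hpinned : ¬ ((∀ m : ℤ, |z m| ≤ 2 → |z (m + 1)| ≤ 2 → z (m + 1) - z m = a * Real.sqrt (2 / 3)) ∧
      (∀ m : ℤ, |z (m - 1)| ≤ 2 → |z (m + 1)| ≤ 2 → s m = s (m - 1)))) :
    A' (layerNormal 1) = A (layerNormal 1) ∨ A' (layerNormal 1) = -A (layerNormal 1) := by
  sorry

end Summit.AtomisticToContinuum.Crystallization.Cruxes.HullBridge.MergeFitsIdeator1
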